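import Mathlib.Analysis.Convex.PathConnected
import Literature.Probability.Percolation.RhombicTilingPlanarity
import Literature.Topology.PlaneTopology.Brouwer
import HarnessLib

/-!
# Crossing walks of an isoradial rhombic tiling meet (planar input of the RSW gluing arguments)

Topic `Literature/Probability/Percolation`; proofs-only support file (no definition, no named
fact) for the arm-comparability fact `GrimmettManolescu2014_armComparability_one_two`
(`IsoradialArmComparability`), whose printed proof (Grimmett–Manolescu, PTRF 159 (2014)
= arXiv:1204.0505, §8) — like every box-crossing argument of that paper (§4.5 Prop.
(grid_bxp), §6, §8.5) — glues open crossings of overlapping rectangles and annuli: "a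
left-right crossing of a rectangle meets every top-bottom crossing" (Kesten 1982, §2.2–2.4;
Bollobás–Riordan 2006, Ch. 3; Grimmett 1999, §11.7). For the lattice `ℤ²` the tree proves this
combinatorially (`exists_mem_support_of_crossing`, `PlanarDuality`); here it is proved for the
primal graph of an **arbitrary isoradial rhombic tiling** (`RhombicEmbedding` with
`IsIsoradial` and `IsRhombicTiling`, `Percolation/Isoradial`), from the crossing lemma of
plane topology (Maehara's lemma `Literature.Topology.PlaneTopology.exists_mem_of_crossing`,
proved in `Topology/PlaneTopology/Brouwer` from Brouwer's fixed point theorem) and the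
planarity of rhombic tilings:

* polygonal paths of walks (`exists_path_range_eq`: a walk `x = v₀ ∼ v₁ ∼ ⋯ ∼ vₙ = y` drawn by
  `z : V → ℂ` is the range `{z x} ∪ ⋃ᵢ [z vᵢ, z vᵢ₊₁]` of a `Path (z x) (z y)`), with range
  control by convex sets (`range_subset_of_convex`);
* the first-exit / last-entrance sub-curve of a curve between two level sets of a continuous
  function (`exists_subcurve_levels`), and its instances: a walk crossing a rectangle
  horizontally (vertically) with slack contains a curve crossing it exactly
  (`exists_hCurve_of_walk`, `exists_vCurve_of_walk`); a walk from `Λ_a` to `∁Λ_b` contains a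
  curve crossing one of the four strips of the square annulus `Λ_b ∖ Λ_a` the short way
  (`exists_stripCurve_of_walk`; sup-norm boxes `Λ_r = {‖·‖_∞ ≤ r}`, `Complex.boxNorm`);
* planarity (from `RhombicTilingPlanarity`: the closed straight edges of two distinct edges of
  `G` meet only at a common endpoint position, `segment_z_inter_segment_z_subset`): two primal
  edges drawn as segments meet only in a common endpoint (`exists_common_vertex_of_mem_segment`)
  and two walks whose polygonal paths meet share a vertex (`exists_mem_support_of_mem_range`);
* the gluing theorems: a horizontal and a vertical crossing walk of a rectangle share a vertex
  (`exists_mem_support_of_crossing_walks`), and a walk from `Λ_a` to `∁Λ_b` shares a vertex with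
  one of any four walks crossing the four strips of `Λ_b ∖ Λ_a` the long way
  (`exists_mem_support_of_radial_walk`) — the deterministic half of "box crossings of the four
  strips form an open circuit in the annulus, which every radial crossing meets"
  (Grimmett–Manolescu 2014, §8.5.2, events `H_M`, `K_m`; Grimmett 1999, §11.7, Fig. 11.9).

All statements are about walks of subgraphs `H ≤ G` of the primal graph (in applications the
open graph of a configuration `ω ⊆ E(G)`), so that they apply verbatim to open paths.

## References

* G. R. Grimmett, I. Manolescu, *Bond percolation on isoradial graphs: criticality and
  universality*, PTRF 159 (2014) 273–327 = arXiv:1204.0505: §2.1 (rhombic tilings), §4.4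
  (equivalence of metrics), §8.5.2 (circuits `H_M`, `K_m` in annuli from box crossings).
* R. Maehara, *The Jordan curve theorem via the Brouwer fixed point theorem*, Amer. Math.
  Monthly 91 (1984) 641–643, Lemma (crossing curves of a rectangle meet).
* H. Kesten, *Percolation Theory for Mathematicians* (1982), §2.2–2.4; G. Grimmett,
  *Percolation*, 2nd ed. (1999), §11.7; B. Bollobás, O. Riordan, *Percolation* (2006), Ch. 3.
-/

noncomputable section

open Set Complex
open Literature.Topology.PlaneTopology

namespace Literature.Probability.Percolation

namespace IsoradialCrossingPaths

open Literature.Probability.LatticeModels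

/-! ### §1 Polygonal paths of walks -/

section Polygonal

variable {V : Type*} {H : SimpleGraph V} (z : V → ℂ)

/-- **The polygonal path of a walk.** A walk `x = v₀ ∼ v₁ ∼ ⋯ ∼ vₙ = y`, drawn with straight
edges by `z : V → ℂ`, is traced by a continuous path from `z x` to `z y` whose range is exactly
`{z x} ∪ ⋃ᵢ [z vᵢ, z vᵢ₊₁]` (the union over the darts of the walk of the closed segments between
their endpoints; the singleton only matters for the trivial walk). Built from Mathlib's
`Path.segment` and `Path.trans`. [folklore] -/
theorem exists_path_range_eq :
    ∀ {x y : V} (p : H.Walk x y), ∃ γ : Path (z x) (z y),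
      range γ = {z x} ∪ ⋃ d ∈ p.darts, segment ℝ (z d.fst) (z d.snd) := by
  intro x y p
  induction p with
  | nil =>
    refine ⟨Path.refl _, ?_⟩
    simp [Path.refl_range]
  | @cons u v w h p ih =>
    obtain ⟨γ, hγ⟩ := ih
    refine ⟨(Path.segment (z u) (z v)).trans γ, ?_⟩
    rw [Path.trans_range, Path.range_segment, hγ, SimpleGraph.Walk.darts_cons]
    ext q
    simp only [mem_union, mem_singleton_iff, mem_iUnion, List.mem_cons, exists_prop]
    constructor
    · rintro (hq | rfl | ⟨d, hd, hq⟩)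
      · exact Or.inr ⟨_, Or.inl rfl, hq⟩
      · exact Or.inr ⟨_, Or.inl rfl, right_mem_segment ℝ (z u) (z v)⟩
      · exact Or.inr ⟨d, Or.inr hd, hq⟩
    · rintro (rfl | ⟨d, rfl | hd, hq⟩)
      · exact Or.inl (left_mem_segment ℝ (z u) (z v))
      · exact Or.inl hq
      · exact Or.inr (Or.inr ⟨d, hd, hq⟩)

/-- The vertices of a walk lie on its polygonal path. [folklore] -/
theorem mem_of_mem_support {x y : V} (p : H.Walk x y) {γ : Path (z x) (z y)}
    (hγ : range γ = {z x} ∪ ⋃ d ∈ p.darts, segment ℝ (z d.fst) (z d.snd)) {v : V}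
    (hv : v ∈ p.support) : z v ∈ range γ := by
  rw [hγ]
  rw [SimpleGraph.Walk.mem_support_iff] at hv
  rcases hv with rfl | hv
  · exact Or.inl rfl
  · rw [← SimpleGraph.Walk.map_snd_darts, List.mem_map] at hv
    obtain ⟨d, hd, rfl⟩ := hv
    exact Or.inr (mem_iUnion₂.2 ⟨d, hd, right_mem_segment ℝ _ _⟩)

/-- **Range control by convex sets**: if all vertices of a walk are drawn in a convex set `C`,
its polygonal path stays in `C`. [folklore] -/
theorem range_subset_of_convex {x y : V} (p : H.Walk x y) {γ : Path (z x) (z y)}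
    (hγ : range γ = {z x} ∪ ⋃ d ∈ p.darts, segment ℝ (z d.fst) (z d.snd)) {C : Set ℂ}
    (hC : Convex ℝ C) (hp : ∀ v ∈ p.support, z v ∈ C) : range γ ⊆ C := by
  rw [hγ]
  rintro q (rfl | hq)
  · exact hp x p.start_mem_support
  · obtain ⟨d, hd, hq⟩ := mem_iUnion₂.1 hq
    exact hC.segment_subset (hp _ (p.dart_fst_mem_support_of_mem_darts hd))
      (hp _ (p.dart_snd_mem_support_of_mem_darts hd)) hq

/-- On a non-trivial walk every point of the polygonal path lies on the segment of some dart
(the initial vertex lies on the first segment). [folklore] -/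
theorem exists_dart_of_mem_range {x y : V} (p : H.Walk x y) (hp : ¬ p.Nil) {γ : Path (z x) (z y)}
    (hγ : range γ = {z x} ∪ ⋃ d ∈ p.darts, segment ℝ (z d.fst) (z d.snd)) {q : ℂ}
    (hq : q ∈ range γ) : ∃ d ∈ p.darts, q ∈ segment ℝ (z d.fst) (z d.snd) := by
  rw [hγ] at hq
  rcases hq with rfl | hq
  · cases p with
    | nil => exact absurd SimpleGraph.Walk.Nil.nil hp
    | cons h p =>
      exact ⟨⟨(_, _), h⟩, by simp [SimpleGraph.Walk.darts_cons], left_mem_segment ℝ _ _⟩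
  · obtain ⟨d, hd, hq⟩ := mem_iUnion₂.1 hq
    exact ⟨d, hd, hq⟩

end Polygonal

/-! ### §2 Sub-curves between two level sets -/

section Subcurve

/-- Reversing a curve parametrised by `[0, 1]`. [folklore] -/
theorem continuousOn_reverse {β : ℝ → ℂ} (hβ : ContinuousOn β (Icc 0 1)) :
    ContinuousOn (fun t => β (1 - t)) (Icc 0 1) :=
  hβ.comp (continuousOn_const.sub continuousOn_id) fun t ht => ⟨by linarith [ht.2], by linarith [ht.1]⟩

/-- The reversed curve has the same trace. [folklore] -/
theorem image_reverse (β : ℝ → ℂ) : (fun t => β (1 - t)) '' Icc 0 1 = β '' Icc 0 1 := by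
  ext q
  constructor
  · rintro ⟨t, ht, rfl⟩
    exact ⟨1 - t, ⟨by linarith [ht.2], by linarith [ht.1]⟩, rfl⟩
  · rintro ⟨t, ht, rfl⟩
    exact ⟨1 - t, ⟨by linarith [ht.2], by linarith [ht.1]⟩, by ring_nf⟩

/-- **First-exit / last-entrance sub-curve between two level sets.** Let `γ` be a curve
(continuous on `[0, 1]`) and `φ` a continuous real function on the plane with
`φ (γ 0) ≤ a ≤ b ≤ φ (γ 1)`. Then some sub-curve of `γ`, reparametrised by `[0, 1]`, runs
inside `{a ≤ φ ≤ b}` from the level set `{φ = a}` to the level set `{φ = b}`: take the first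
parameter `s₁` with `φ (γ s₁) ≥ b` and then the last parameter `s₀ ≤ s₁` with `φ (γ s₀) ≤ a`
(infimum / supremum of closed sets, intermediate value theorem). This is the continuous form of
the last-exit decomposition of paths used throughout planar percolation (Kesten 1982, §2.2;
Grimmett–Manolescu 2014, §8.5.2). [folklore] -/
theorem exists_subcurve_levels {γ : ℝ → ℂ} (hγ : ContinuousOn γ (Icc 0 1)) {φ : ℂ → ℝ}
    (hφ : Continuous φ) {a b : ℝ} (hab : a ≤ b) (h0 : φ (γ 0) ≤ a) (h1 : b ≤ φ (γ 1)) :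
    ∃ β : ℝ → ℂ, ContinuousOn β (Icc 0 1) ∧ β '' Icc 0 1 ⊆ γ '' Icc 0 1 ∧
      (∀ t ∈ Icc (0 : ℝ) 1, φ (β t) ∈ Icc a b) ∧ φ (β 0) = a ∧ φ (β 1) = b := by
  set g : ℝ → ℝ := fun s => φ (γ s) with hg
  have hgc : ContinuousOn g (Icc 0 1) := hφ.comp_continuousOn hγ
  -- first parameter with `g ≥ b`
  set T : Set ℝ := Icc 0 1 ∩ g ⁻¹' Ici b with hT
  have hTc : IsClosed T := hgc.preimage_isClosed_of_isClosed isClosed_Icc isClosed_Ici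
  have h1T : (1 : ℝ) ∈ T := ⟨⟨zero_le_one, le_rfl⟩, h1⟩
  have hTbdd : BddBelow T := ⟨0, fun s hs => hs.1.1⟩
  set s₁ := sInf T with hs₁
  have hs₁T : s₁ ∈ T := hTc.csInf_mem ⟨1, h1T⟩ hTbdd
  have hs₁I : s₁ ∈ Icc (0 : ℝ) 1 := hs₁T.1
  have hlt₁ : ∀ s ∈ Icc (0 : ℝ) 1, s < s₁ → g s < b := by
    intro s hs hss
    by_contra hle
    exact not_le.2 hss (csInf_le hTbdd ⟨hs, not_lt.1 hle⟩)
  have hg₁ : g s₁ = b := by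
    have hsub : Icc 0 s₁ ⊆ Icc (0 : ℝ) 1 := Icc_subset_Icc le_rfl hs₁I.2
    obtain ⟨s, hs, hgs⟩ := intermediate_value_Icc hs₁I.1 (hgc.mono hsub)
      ⟨h0.trans hab, (hs₁T.2 : b ≤ g s₁)⟩
    have hsT : s ∈ T := ⟨hsub hs, le_of_eq hgs.symm⟩
    have : s₁ ≤ s := csInf_le hTbdd hsT
    rw [← hgs, le_antisymm hs.2 this]
  -- last parameter before `s₁` with `g ≤ a`
  set S : Set ℝ := Icc 0 s₁ ∩ g ⁻¹' Iic a with hS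
  have hsub₁ : Icc 0 s₁ ⊆ Icc (0 : ℝ) 1 := Icc_subset_Icc le_rfl hs₁I.2
  have hSc : IsClosed S := (hgc.mono hsub₁).preimage_isClosed_of_isClosed isClosed_Icc isClosed_Iic
  have h0S : (0 : ℝ) ∈ S := ⟨⟨le_rfl, hs₁I.1⟩, h0⟩
  have hSbdd : BddAbove S := ⟨s₁, fun s hs => hs.1.2⟩
  set s₀ := sSup S with hs₀
  have hs₀S : s₀ ∈ S := hSc.csSup_mem ⟨0, h0S⟩ hSbdd
  have hs₀I : s₀ ∈ Icc (0 : ℝ) s₁ := hs₀S.1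
  have hgt₀ : ∀ s ∈ Icc (0 : ℝ) s₁, s₀ < s → a < g s := by
    intro s hs hss
    by_contra hle
    exact not_le.2 hss (le_csSup hSbdd ⟨hs, not_lt.1 hle⟩)
  have hg₀ : g s₀ = a := by
    have hsub : Icc s₀ s₁ ⊆ Icc (0 : ℝ) 1 := (Icc_subset_Icc hs₀I.1 le_rfl).trans hsub₁
    obtain ⟨s, hs, hgs⟩ := intermediate_value_Icc hs₀I.2 (hgc.mono hsub)
      ⟨(hs₀S.2 : g s₀ ≤ a), hab.trans (le_of_eq hg₁.symm)⟩
    have hsS : s ∈ S := ⟨⟨hs₀I.1.trans hs.1, hs.2⟩, le_of_eq hgs⟩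
    have : s ≤ s₀ := le_csSup hSbdd hsS
    rw [← hgs, le_antisymm this hs.1]
  -- the reparametrised sub-curve
  have hmaps : ∀ t ∈ Icc (0 : ℝ) 1, s₀ + t * (s₁ - s₀) ∈ Icc s₀ s₁ := by
    intro t ht
    have hd : 0 ≤ s₁ - s₀ := sub_nonneg.2 hs₀I.2
    constructor <;> nlinarith [ht.1, ht.2]
  have hsub : Icc s₀ s₁ ⊆ Icc (0 : ℝ) 1 := (Icc_subset_Icc hs₀I.1 le_rfl).trans hsub₁
  refine ⟨fun t => γ (s₀ + t * (s₁ - s₀)), ?_, ?_, ?_, ?_, ?_⟩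
  · exact hγ.comp (Continuous.continuousOn (by fun_prop)) fun t ht => hsub (hmaps t ht)
  · rintro q ⟨t, ht, rfl⟩
    exact ⟨_, hsub (hmaps t ht), rfl⟩
  · intro t ht
    have hst := hmaps t ht
    refine ⟨?_, ?_⟩
    · rcases eq_or_lt_of_le hst.1 with h | h
      · show a ≤ g _; rw [← h, hg₀]
      · exact (hgt₀ _ ⟨hs₀I.1.trans hst.1, hst.2⟩ h).le
    · rcases eq_or_lt_of_le hst.2 with h | h
      · show g _ ≤ b; rw [h, hg₁]
      · exact (hlt₁ _ (hsub hst) h).le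
  · show g (s₀ + 0 * (s₁ - s₀)) = a
    rw [zero_mul, add_zero, hg₀]
  · show g (s₀ + 1 * (s₁ - s₀)) = b
    rw [one_mul, add_sub_cancel, hg₁]

end Subcurve

/-! ### §3 Curves extracted from crossing walks -/

section WalkCurves

variable {V : Type*} {H : SimpleGraph V} (z : V → ℂ)

/-- The horizontal strip `{b₁ ≤ im ≤ b₂}` is convex. [folklore] -/
theorem convex_im_mem_Icc (b₁ b₂ : ℝ) : Convex ℝ {q : ℂ | q.im ∈ Icc b₁ b₂} := by
  have hlin : IsLinearMap ℝ (fun q : ℂ => q.im) :=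
    ⟨fun q q' => Complex.add_im q q', fun c q => by simp⟩
  have : {q : ℂ | q.im ∈ Icc b₁ b₂} = {q : ℂ | b₁ ≤ q.im} ∩ {q : ℂ | q.im ≤ b₂} := by
    ext q; simp [mem_Icc]
  rw [this]
  exact (convex_halfSpace_ge hlin b₁).inter (convex_halfSpace_le hlin b₂)

/-- The vertical strip `{a₁ ≤ re ≤ a₂}` is convex. [folklore] -/
theorem convex_re_mem_Icc (a₁ a₂ : ℝ) : Convex ℝ {q : ℂ | q.re ∈ Icc a₁ a₂} := by
  have hlin : IsLinearMap ℝ (fun q : ℂ => q.re) :=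
    ⟨fun q q' => Complex.add_re q q', fun c q => by simp⟩
  have : {q : ℂ | q.re ∈ Icc a₁ a₂} = {q : ℂ | a₁ ≤ q.re} ∩ {q : ℂ | q.re ≤ a₂} := by
    ext q; simp [mem_Icc]
  rw [this]
  exact (convex_halfSpace_ge hlin a₁).inter (convex_halfSpace_le hlin a₂)

/-- The sup norm `max |re| |im|` is continuous. [folklore] -/
theorem continuous_boxNorm : Continuous fun w : ℂ => w.boxNorm := by
  show Continuous fun w : ℂ => max |w.re| |w.im|
  fun_prop

/-- The trace on `[0, 1]` of the extension of a path is contained in its range. [folklore] -/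
theorem image_extend_subset_range {a b : ℂ} (γ : Path a b) : γ.extend '' Icc 0 1 ⊆ range γ :=
  (γ.image_extend_of_subset Subset.rfl).le

/-- **A walk crossing a rectangle horizontally, with slack, contains a curve crossing it
exactly.** If a walk runs from `{re ≤ a₁}` to `{a₂ ≤ re}` (`a₁ ≤ a₂`) with all vertices in the
horizontal strip `{b₁ ≤ im ≤ b₂}`, its polygonal path contains a curve in the rectangle
`[a₁, a₂] × [b₁, b₂]` joining its left side to its right side. (Bollobás–Riordan 2006, Ch. 3;
the reduction of lattice crossings to the curves of Maehara's lemma.) [folklore] -/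
theorem exists_hCurve_of_walk {x y : V} (p : H.Walk x y) {a₁ a₂ b₁ b₂ : ℝ} (ha : a₁ ≤ a₂)
    (hx : (z x).re ≤ a₁) (hy : a₂ ≤ (z y).re) (hsupp : ∀ v ∈ p.support, (z v).im ∈ Icc b₁ b₂) :
    ∃ (γ : Path (z x) (z y)) (β : ℝ → ℂ),
      range γ = {z x} ∪ ⋃ d ∈ p.darts, segment ℝ (z d.fst) (z d.snd) ∧
      ContinuousOn β (Icc 0 1) ∧ β '' Icc 0 1 ⊆ range γ ∧
      MapsTo β (Icc 0 1) (Icc a₁ a₂ ×ℂ Icc b₁ b₂) ∧ (β 0).re = a₁ ∧ (β 1).re = a₂ := by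
  obtain ⟨γ, hγ⟩ := exists_path_range_eq z p
  have hrange : range γ ⊆ {q : ℂ | q.im ∈ Icc b₁ b₂} :=
    range_subset_of_convex z p hγ (convex_im_mem_Icc b₁ b₂) hsupp
  obtain ⟨β, hβc, hβim, hβlev, hβ0, hβ1⟩ := exists_subcurve_levels γ.continuous_extend.continuousOn
    continuous_re ha (by rw [γ.extend_zero]; exact hx) (by rw [γ.extend_one]; exact hy)
  have hβr : β '' Icc 0 1 ⊆ range γ := hβim.trans (image_extend_subset_range γ)
  refine ⟨γ, β, hγ, hβc, hβr, fun t ht => ?_, hβ0, hβ1⟩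
  rw [mem_reProdIm]
  exact ⟨hβlev t ht, hrange (hβr ⟨t, ht, rfl⟩)⟩

/-- **A walk crossing a rectangle vertically, with slack, contains a curve crossing it
exactly** (the transposed form of `exists_hCurve_of_walk`). [folklore] -/
theorem exists_vCurve_of_walk {x y : V} (p : H.Walk x y) {a₁ a₂ b₁ b₂ : ℝ} (hb : b₁ ≤ b₂)
    (hx : (z x).im ≤ b₁) (hy : b₂ ≤ (z y).im) (hsupp : ∀ v ∈ p.support, (z v).re ∈ Icc a₁ a₂) :
    ∃ (γ : Path (z x) (z y)) (β : ℝ → ℂ),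
      range γ = {z x} ∪ ⋃ d ∈ p.darts, segment ℝ (z d.fst) (z d.snd) ∧
      ContinuousOn β (Icc 0 1) ∧ β '' Icc 0 1 ⊆ range γ ∧
      MapsTo β (Icc 0 1) (Icc a₁ a₂ ×ℂ Icc b₁ b₂) ∧ (β 0).im = b₁ ∧ (β 1).im = b₂ := by
  obtain ⟨γ, hγ⟩ := exists_path_range_eq z p
  have hrange : range γ ⊆ {q : ℂ | q.re ∈ Icc a₁ a₂} :=
    range_subset_of_convex z p hγ (convex_re_mem_Icc a₁ a₂) hsupp
  obtain ⟨β, hβc, hβim, hβlev, hβ0, hβ1⟩ := exists_subcurve_levels γ.continuous_extend.continuousOn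
    continuous_im hb (by rw [γ.extend_zero]; exact hx) (by rw [γ.extend_one]; exact hy)
  have hβr : β '' Icc 0 1 ⊆ range γ := hβim.trans (image_extend_subset_range γ)
  refine ⟨γ, β, hγ, hβc, hβr, fun t ht => ?_, hβ0, hβ1⟩
  rw [mem_reProdIm]
  exact ⟨hrange (hβr ⟨t, ht, rfl⟩), hβlev t ht⟩

/-- **A walk from the box `Λ_a` to the outside of the box `Λ_b` crosses one of the four strips
of the square annulus `Λ_b ∖ Λ_a` the short way** (`0 ≤ a ≤ b`, `Λ_r = {‖·‖_∞ ≤ r}`): its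
polygonal path contains a curve which is either a bottom-top crossing of the top strip
`[-b, b] × [a, b]` or of the bottom strip `[-b, b] × [-b, -a]`, or a left-right crossing of the
right strip `[a, b] × [-b, b]` or of the left strip `[-b, -a] × [-b, b]`. (First restrict the
path between its last visit to `∂Λ_a` and its first visit to `∂Λ_b`; the endpoint on `∂Λ_b`
lies on one of the four sides, and a second restriction in the corresponding coordinate gives
the crossing.) This is the geometric step of Grimmett–Manolescu 2014, §8.5.2 ("any open
crossing of the annulus meets the circuit") and of Grimmett 1999, §11.7.
[cite: GrimmettManolescu2014Isoradial, §8.5.2 (circuits in annuli built from box crossings)] -/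
theorem exists_stripCurve_of_walk {x y : V} (p : H.Walk x y) {a b : ℝ} (hab : a ≤ b)
    (hx : (z x).boxNorm ≤ a) (hy : b ≤ (z y).boxNorm) :
    ∃ (γ : Path (z x) (z y)) (β : ℝ → ℂ),
      range γ = {z x} ∪ ⋃ d ∈ p.darts, segment ℝ (z d.fst) (z d.snd) ∧
      ContinuousOn β (Icc 0 1) ∧ β '' Icc 0 1 ⊆ range γ ∧
      ((MapsTo β (Icc 0 1) (Icc (-b) b ×ℂ Icc a b) ∧ (β 0).im = a ∧ (β 1).im = b) ∨
        (MapsTo β (Icc 0 1) (Icc (-b) b ×ℂ Icc (-b) (-a)) ∧ (β 0).im = -b ∧ (β 1).im = -a) ∨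
        (MapsTo β (Icc 0 1) (Icc a b ×ℂ Icc (-b) b) ∧ (β 0).re = a ∧ (β 1).re = b) ∨
        (MapsTo β (Icc 0 1) (Icc (-b) (-a) ×ℂ Icc (-b) b) ∧ (β 0).re = -b ∧ (β 1).re = -a)) := by
  obtain ⟨γ, hγ⟩ := exists_path_range_eq z p
  -- radial restriction: between the last visit to `∂Λ_a` and the first visit to `∂Λ_b`
  obtain ⟨β₁, hβ₁c, hβ₁im, hβ₁lev, hβ₁0, hβ₁1⟩ :=
    exists_subcurve_levels γ.continuous_extend.continuousOn continuous_boxNorm hab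
      (by rw [γ.extend_zero]; exact hx) (by rw [γ.extend_one]; exact hy)
  have hβ₁r : β₁ '' Icc 0 1 ⊆ range γ := hβ₁im.trans (image_extend_subset_range γ)
  have h0I : (0 : ℝ) ∈ Icc (0 : ℝ) 1 := ⟨le_rfl, zero_le_one⟩
  have h1I : (1 : ℝ) ∈ Icc (0 : ℝ) 1 := ⟨zero_le_one, le_rfl⟩
  have hb0 : 0 ≤ b := by rw [← hβ₁1]; exact IsoradialCriticality.boxNorm_nonneg _
  -- bounds valid on every sub-curve of `β₁`
  have hre : ∀ q ∈ β₁ '' Icc 0 1, q.re ∈ Icc (-b) b := by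
    rintro q ⟨t, ht, rfl⟩
    have h := (IsoradialCriticality.abs_re_le_boxNorm (β₁ t)).trans (hβ₁lev t ht).2
    exact ⟨by linarith [neg_abs_le (β₁ t).re], (le_abs_self _).trans h⟩
  have him : ∀ q ∈ β₁ '' Icc 0 1, q.im ∈ Icc (-b) b := by
    rintro q ⟨t, ht, rfl⟩
    have h := (IsoradialCriticality.abs_im_le_boxNorm (β₁ t)).trans (hβ₁lev t ht).2
    exact ⟨by linarith [neg_abs_le (β₁ t).im], (le_abs_self _).trans h⟩
  have him0 : |(β₁ 0).im| ≤ a := (IsoradialCriticality.abs_im_le_boxNorm (β₁ 0)).trans (le_of_eq hβ₁0)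
  have hre0 : |(β₁ 0).re| ≤ a := (IsoradialCriticality.abs_re_le_boxNorm (β₁ 0)).trans (le_of_eq hβ₁0)
  -- the endpoint on `∂Λ_b` lies on one of the four sides
  have hside : (β₁ 1).im = b ∨ (β₁ 1).im = -b ∨ (β₁ 1).re = b ∨ (β₁ 1).re = -b := by
    have h1 : max |(β₁ 1).re| |(β₁ 1).im| = b := hβ₁1
    rcases max_choice |(β₁ 1).re| |(β₁ 1).im| with h | h
    · rw [h] at h1
      rcases (abs_eq hb0).1 h1 with h' | h'
      · exact Or.inr (Or.inr (Or.inl h'))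
      · exact Or.inr (Or.inr (Or.inr h'))
    · rw [h] at h1
      rcases (abs_eq hb0).1 h1 with h' | h'
      · exact Or.inl h'
      · exact Or.inr (Or.inl h')
  rcases hside with h1 | h1 | h1 | h1
  · -- top strip
    obtain ⟨β, hβc, hβim, hβlev, hβ0, hβ1⟩ := exists_subcurve_levels hβ₁c continuous_im hab
      ((le_abs_self _).trans him0) (le_of_eq h1.symm)
    refine ⟨γ, β, hγ, hβc, hβim.trans hβ₁r, Or.inl ⟨fun t ht => ?_, hβ0, hβ1⟩⟩
    rw [mem_reProdIm]
    exact ⟨hre _ (hβim ⟨t, ht, rfl⟩), hβlev t ht⟩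
  · -- bottom strip (reverse the sub-curve)
    obtain ⟨β, hβc, hβim, hβlev, hβ0, hβ1⟩ := exists_subcurve_levels hβ₁c
      (φ := fun w : ℂ => -w.im) (by fun_prop) hab
      ((neg_le_abs _).trans him0) (show b ≤ -(β₁ 1).im by linarith)
    refine ⟨γ, fun t => β (1 - t), hγ, continuousOn_reverse hβc, ?_,
      Or.inr (Or.inl ⟨fun t ht => ?_, ?_, ?_⟩)⟩
    · rw [image_reverse]; exact hβim.trans hβ₁r
    · rw [mem_reProdIm]
      have ht' : 1 - t ∈ Icc (0 : ℝ) 1 := ⟨by linarith [ht.2], by linarith [ht.1]⟩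
      have hl : a ≤ -(β (1 - t)).im ∧ -(β (1 - t)).im ≤ b := hβlev (1 - t) ht'
      exact ⟨hre _ (hβim ⟨1 - t, ht', rfl⟩), ⟨by linarith [hl.2], by linarith [hl.1]⟩⟩
    · have h : -(β 1).im = b := hβ1
      show (β (1 - 0)).im = -b
      rw [sub_zero]; linarith
    · have h : -(β 0).im = a := hβ0
      show (β (1 - 1)).im = -a
      rw [sub_self]; linarith
  · -- right strip
    obtain ⟨β, hβc, hβim, hβlev, hβ0, hβ1⟩ := exists_subcurve_levels hβ₁c continuous_re hab
      ((le_abs_self _).trans hre0) (le_of_eq h1.symm)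
    refine ⟨γ, β, hγ, hβc, hβim.trans hβ₁r, Or.inr (Or.inr (Or.inl ⟨fun t ht => ?_, hβ0, hβ1⟩))⟩
    rw [mem_reProdIm]
    exact ⟨hβlev t ht, him _ (hβim ⟨t, ht, rfl⟩)⟩
  · -- left strip (reverse the sub-curve)
    obtain ⟨β, hβc, hβim, hβlev, hβ0, hβ1⟩ := exists_subcurve_levels hβ₁c
      (φ := fun w : ℂ => -w.re) (by fun_prop) hab
      ((neg_le_abs _).trans hre0) (show b ≤ -(β₁ 1).re by linarith)
    refine ⟨γ, fun t => β (1 - t), hγ, continuousOn_reverse hβc, ?_,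
      Or.inr (Or.inr (Or.inr ⟨fun t ht => ?_, ?_, ?_⟩))⟩
    · rw [image_reverse]; exact hβim.trans hβ₁r
    · rw [mem_reProdIm]
      have ht' : 1 - t ∈ Icc (0 : ℝ) 1 := ⟨by linarith [ht.2], by linarith [ht.1]⟩
      have hl : a ≤ -(β (1 - t)).re ∧ -(β (1 - t)).re ≤ b := hβlev (1 - t) ht'
      exact ⟨⟨by linarith [hl.2], by linarith [hl.1]⟩, him _ (hβim ⟨1 - t, ht', rfl⟩)⟩
    · have h : -(β 1).re = b := hβ1
      show (β (1 - 0)).re = -b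
      rw [sub_zero]; linarith
    · have h : -(β 0).re = a := hβ0
      show (β (1 - 1)).re = -a
      rw [sub_self]; linarith

end WalkCurves

/-! ### §4 Planarity of isoradial rhombic tilings -/

section Planarity

variable {V F : Type*} {G : SimpleGraph V} (emb : RhombicEmbedding G F)

/-- **Two edges of a rhombic tiling, drawn as segments, meet only in a common endpoint**: if the
closed segments of two darts `d`, `d'` have a common point, then `d` and `d'` have a common
endpoint (a vertex of `G`). For distinct edges this is the plane-drawing property
`segment_z_inter_segment_z_subset` of `RhombicTilingPlanarity` (open diagonals lie in the
disjoint interiors of the rhombi, and no vertex is interior to a rhombus) together with the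
injectivity of `z`. [cite: GrimmettManolescu2014Isoradial, §4.1 (planarity of the rhombic tiling G^◇)] -/
theorem exists_common_vertex_of_mem_segment (hiso : emb.IsIsoradial) (hrh : emb.IsRhombicTiling)
    (d d' : G.Dart) {q : ℂ} (hq : q ∈ segment ℝ (emb.z d.fst) (emb.z d.snd))
    (hq' : q ∈ segment ℝ (emb.z d'.fst) (emb.z d'.snd)) :
    ∃ v : V, (v = d.fst ∨ v = d.snd) ∧ (v = d'.fst ∨ v = d'.snd) := by
  by_cases he : d.edge = d'.edge
  · rcases (SimpleGraph.dart_edge_eq_iff d d').1 he with h | h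
    · exact ⟨d.fst, Or.inl rfl, Or.inl (by rw [h])⟩
    · refine ⟨d.fst, Or.inl rfl, Or.inr ?_⟩
      rw [h]
      simp [SimpleGraph.Dart.symm_toProd]
  · obtain ⟨h1, h2⟩ := segment_z_inter_segment_z_subset hiso hrh he ⟨hq, hq'⟩
    simp only [mem_insert_iff, mem_singleton_iff] at h1 h2
    rcases h1 with h | h <;> rcases h2 with h' | h' <;> rw [h] at h'
    · exact ⟨d.fst, Or.inl rfl, Or.inl (hiso.z_injective h')⟩
    · exact ⟨d.fst, Or.inl rfl, Or.inr (hiso.z_injective h')⟩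
    · exact ⟨d.snd, Or.inr rfl, Or.inl (hiso.z_injective h')⟩
    · exact ⟨d.snd, Or.inr rfl, Or.inr (hiso.z_injective h')⟩

/-- **Walks of an isoradial rhombic tiling whose polygonal paths meet share a vertex.** Here
the walks live in subgraphs `H₁, H₂` of the primal graph `G` (e.g. open subgraphs) and are
non-trivial. [cite: GrimmettManolescu2014Isoradial, §2.1 (planarity of G^◇)] -/
theorem exists_mem_support_of_mem_range (hiso : emb.IsIsoradial) (hrh : emb.IsRhombicTiling)
    {H₁ H₂ : SimpleGraph V} (h₁ : ∀ ⦃a b : V⦄, H₁.Adj a b → G.Adj a b)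
    (h₂ : ∀ ⦃a b : V⦄, H₂.Adj a b → G.Adj a b) {x₁ y₁ x₂ y₂ : V} (p₁ : H₁.Walk x₁ y₁)
    (p₂ : H₂.Walk x₂ y₂) (hp₁ : ¬ p₁.Nil) (hp₂ : ¬ p₂.Nil) {γ₁ : Path (emb.z x₁) (emb.z y₁)}
    {γ₂ : Path (emb.z x₂) (emb.z y₂)}
    (hγ₁ : range γ₁ = {emb.z x₁} ∪ ⋃ d ∈ p₁.darts, segment ℝ (emb.z d.fst) (emb.z d.snd))
    (hγ₂ : range γ₂ = {emb.z x₂} ∪ ⋃ d ∈ p₂.darts, segment ℝ (emb.z d.fst) (emb.z d.snd))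
    {q : ℂ} (hq₁ : q ∈ range γ₁) (hq₂ : q ∈ range γ₂) : ∃ v ∈ p₁.support, v ∈ p₂.support := by
  obtain ⟨d₁, hd₁, hq₁'⟩ := exists_dart_of_mem_range emb.z p₁ hp₁ hγ₁ hq₁
  obtain ⟨d₂, hd₂, hq₂'⟩ := exists_dart_of_mem_range emb.z p₂ hp₂ hγ₂ hq₂
  set D₁ : G.Dart := ⟨(d₁.fst, d₁.snd), h₁ d₁.adj⟩ with hD₁
  set D₂ : G.Dart := ⟨(d₂.fst, d₂.snd), h₂ d₂.adj⟩ with hD₂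
  obtain ⟨v, hv₁, hv₂⟩ := exists_common_vertex_of_mem_segment emb hiso hrh D₁ D₂ hq₁' hq₂'
  refine ⟨v, ?_, ?_⟩
  · rcases hv₁ with rfl | rfl
    · exact p₁.dart_fst_mem_support_of_mem_darts hd₁
    · exact p₁.dart_snd_mem_support_of_mem_darts hd₁
  · rcases hv₂ with rfl | rfl
    · exact p₂.dart_fst_mem_support_of_mem_darts hd₂
    · exact p₂.dart_snd_mem_support_of_mem_darts hd₂

end Planarity

/-! ### §5 Crossing walks meet -/

section Meet

variable {V F : Type*} {G : SimpleGraph V} (emb : RhombicEmbedding G F)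

/-- **A horizontal and a vertical crossing walk of a rectangle share a vertex.** In an isoradial
rhombic tiling, let `p₁` be a walk from `{re ≤ a₁}` to `{a₂ ≤ re}` with all vertices in the
strip `{b₁ ≤ im ≤ b₂}` and `p₂` a walk from `{im ≤ b₁}` to `{b₂ ≤ im}` with all vertices in the
strip `{a₁ ≤ re ≤ a₂}` (`a₁ < a₂`, `b₁ < b₂`; walks of subgraphs of the primal graph). Then `p₁`
and `p₂` have a common vertex. (Maehara's crossing lemma for the extracted curves, then
planarity.) This is the basic gluing step of every RSW-type argument (Kesten 1982, §2.2;
Grimmett 1999, §11.7: "the left-right crossing … must intersect the top-bottom crossing";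
Grimmett–Manolescu 2014, §8.5.2). [cite: GrimmettManolescu2014Isoradial, §8.5.2 (gluing of box crossings)] -/
theorem exists_mem_support_of_crossing_walks (hiso : emb.IsIsoradial) (hrh : emb.IsRhombicTiling)
    {H₁ H₂ : SimpleGraph V} (h₁ : ∀ ⦃a b : V⦄, H₁.Adj a b → G.Adj a b)
    (h₂ : ∀ ⦃a b : V⦄, H₂.Adj a b → G.Adj a b) {x₁ y₁ x₂ y₂ : V} (p₁ : H₁.Walk x₁ y₁)
    (p₂ : H₂.Walk x₂ y₂) {a₁ a₂ b₁ b₂ : ℝ} (ha : a₁ < a₂) (hb : b₁ < b₂)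
    (hx₁ : (emb.z x₁).re ≤ a₁) (hy₁ : a₂ ≤ (emb.z y₁).re)
    (hs₁ : ∀ v ∈ p₁.support, (emb.z v).im ∈ Icc b₁ b₂)
    (hx₂ : (emb.z x₂).im ≤ b₁) (hy₂ : b₂ ≤ (emb.z y₂).im)
    (hs₂ : ∀ v ∈ p₂.support, (emb.z v).re ∈ Icc a₁ a₂) :
    ∃ v ∈ p₁.support, v ∈ p₂.support := by
  obtain ⟨γ₁, βh, hγ₁, hβhc, hβhr, hβhK, hβh0, hβh1⟩ :=
    exists_hCurve_of_walk emb.z p₁ ha.le hx₁ hy₁ hs₁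
  obtain ⟨γ₂, βv, hγ₂, hβvc, hβvr, hβvK, hβv0, hβv1⟩ :=
    exists_vCurve_of_walk emb.z p₂ hb.le hx₂ hy₂ hs₂
  obtain ⟨s, hs, t, ht, hst⟩ := exists_mem_of_crossing hβvc hβhc hβvK hβhK hβv0 hβv1 hβh0 hβh1
  have hp₁ : ¬ p₁.Nil := by
    intro h
    have := h.eq
    subst this
    linarith
  have hp₂ : ¬ p₂.Nil := by
    intro h
    have := h.eq
    subst this
    linarith
  exact exists_mem_support_of_mem_range emb hiso hrh h₁ h₂ p₁ p₂ hp₁ hp₂ hγ₁ hγ₂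
    (hβhr ⟨s, hs, rfl⟩) (hst ▸ hβvr ⟨t, ht, rfl⟩)

/-- **A radial crossing of a square annulus meets the box crossings of its four strips.** In an
isoradial rhombic tiling let `0 ≤ a < b`, let `p` be a walk from `Λ_a = {‖·‖_∞ ≤ a}` to
`{b ≤ ‖·‖_∞}`, and let four walks cross the four strips of `Λ_b ∖ Λ_a` the long way: `pt` from
`{re ≤ -b}` to `{b ≤ re}` inside `{a ≤ im ≤ b}`, `pb` likewise inside `{-b ≤ im ≤ -a}`, `pl`
from `{im ≤ -b}` to `{b ≤ im}` inside `{-b ≤ re ≤ -a}` and `pr` likewise inside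
`{a ≤ re ≤ b}`. Then `p` shares a vertex with one of `pt, pb, pl, pr`. This is the
deterministic content of "the four box crossings form an open circuit in the annulus, and any
crossing of the annulus meets it" (Grimmett–Manolescu 2014, §8.5.2, the events `H_M`, `K_m`;
Grimmett 1999, §11.7, Fig. 11.9). [cite: GrimmettManolescu2014Isoradial, §8.5.2 (circuits in annuli from box crossings)] -/
theorem exists_mem_support_of_radial_walk (hiso : emb.IsIsoradial) (hrh : emb.IsRhombicTiling)
    {H K : SimpleGraph V} (hH : ∀ ⦃u v : V⦄, H.Adj u v → G.Adj u v)
    (hK : ∀ ⦃u v : V⦄, K.Adj u v → G.Adj u v) {a b : ℝ} (ha : 0 ≤ a) (hab : a < b)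
    {x y : V} (p : H.Walk x y) (hx : (emb.z x).boxNorm ≤ a) (hy : b ≤ (emb.z y).boxNorm)
    {xt yt xb yb xl yl xr yr : V} (pt : K.Walk xt yt) (pb : K.Walk xb yb) (pl : K.Walk xl yl)
    (pr : K.Walk xr yr)
    (hxt : (emb.z xt).re ≤ -b) (hyt : b ≤ (emb.z yt).re)
    (hst : ∀ v ∈ pt.support, (emb.z v).im ∈ Icc a b)
    (hxb : (emb.z xb).re ≤ -b) (hyb : b ≤ (emb.z yb).re)
    (hsb : ∀ v ∈ pb.support, (emb.z v).im ∈ Icc (-b) (-a))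
    (hxl : (emb.z xl).im ≤ -b) (hyl : b ≤ (emb.z yl).im)
    (hsl : ∀ v ∈ pl.support, (emb.z v).re ∈ Icc (-b) (-a))
    (hxr : (emb.z xr).im ≤ -b) (hyr : b ≤ (emb.z yr).im)
    (hsr : ∀ v ∈ pr.support, (emb.z v).re ∈ Icc a b) :
    ∃ v ∈ p.support, v ∈ pt.support ∨ v ∈ pb.support ∨ v ∈ pl.support ∨ v ∈ pr.support := by
  have hb : 0 < b := lt_of_le_of_lt ha hab
  have hbb : -b < b := by linarith
  have hp : ¬ p.Nil := by
    intro h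
    have := h.eq
    subst this
    linarith
  obtain ⟨γ, β, hγ, hβc, hβr, hcases⟩ := exists_stripCurve_of_walk emb.z p hab.le hx hy
  rcases hcases with ⟨hβK, hβ0, hβ1⟩ | ⟨hβK, hβ0, hβ1⟩ | ⟨hβK, hβ0, hβ1⟩ | ⟨hβK, hβ0, hβ1⟩
  · -- top strip, against `pt`
    obtain ⟨γ', β', hγ', hβ'c, hβ'r, hβ'K, hβ'0, hβ'1⟩ :=
      exists_hCurve_of_walk emb.z pt hbb.le hxt hyt hst
    obtain ⟨s, hs, t, ht, hst'⟩ := exists_mem_of_crossing hβc hβ'c hβK hβ'K hβ0 hβ1 hβ'0 hβ'1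
    have hpt : ¬ pt.Nil := by
      intro h
      have := h.eq
      subst this
      linarith
    obtain ⟨v, hv, hv'⟩ := exists_mem_support_of_mem_range emb hiso hrh hH hK p pt hp hpt hγ hγ'
      (hst' ▸ hβr ⟨t, ht, rfl⟩) (hβ'r ⟨s, hs, rfl⟩)
    exact ⟨v, hv, Or.inl hv'⟩
  · -- bottom strip, against `pb`
    have hba : -b ≤ -a := by linarith
    obtain ⟨γ', β', hγ', hβ'c, hβ'r, hβ'K, hβ'0, hβ'1⟩ :=
      exists_hCurve_of_walk emb.z pb hbb.le hxb hyb hsb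
    obtain ⟨s, hs, t, ht, hst'⟩ := exists_mem_of_crossing hβc hβ'c hβK hβ'K hβ0 hβ1 hβ'0 hβ'1
    have hpb : ¬ pb.Nil := by
      intro h
      have := h.eq
      subst this
      linarith
    obtain ⟨v, hv, hv'⟩ := exists_mem_support_of_mem_range emb hiso hrh hH hK p pb hp hpb hγ hγ'
      (hst' ▸ hβr ⟨t, ht, rfl⟩) (hβ'r ⟨s, hs, rfl⟩)
    exact ⟨v, hv, Or.inr (Or.inl hv')⟩
  · -- right strip, against `pr`
    obtain ⟨γ', β', hγ', hβ'c, hβ'r, hβ'K, hβ'0, hβ'1⟩ :=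
      exists_vCurve_of_walk emb.z pr hbb.le hxr hyr hsr
    obtain ⟨s, hs, t, ht, hst'⟩ := exists_mem_of_crossing hβ'c hβc hβ'K hβK hβ'0 hβ'1 hβ0 hβ1
    have hpr : ¬ pr.Nil := by
      intro h
      have := h.eq
      subst this
      linarith
    obtain ⟨v, hv, hv'⟩ := exists_mem_support_of_mem_range emb hiso hrh hH hK p pr hp hpr hγ hγ'
      (hβr ⟨s, hs, rfl⟩) (hst' ▸ hβ'r ⟨t, ht, rfl⟩)
    exact ⟨v, hv, Or.inr (Or.inr (Or.inr hv'))⟩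
  · -- left strip, against `pl`
    obtain ⟨γ', β', hγ', hβ'c, hβ'r, hβ'K, hβ'0, hβ'1⟩ :=
      exists_vCurve_of_walk emb.z pl hbb.le hxl hyl hsl
    obtain ⟨s, hs, t, ht, hst'⟩ := exists_mem_of_crossing hβ'c hβc hβ'K hβK hβ'0 hβ'1 hβ0 hβ1
    have hpl : ¬ pl.Nil := by
      intro h
      have := h.eq
      subst this
      linarith
    obtain ⟨v, hv, hv'⟩ := exists_mem_support_of_mem_range emb hiso hrh hH hK p pl hp hpl hγ hγ'
      (hβr ⟨s, hs, rfl⟩) (hst' ▸ hβ'r ⟨t, ht, rfl⟩)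
    exact ⟨v, hv, Or.inr (Or.inr (Or.inl hv'))⟩

end Meet

end IsoradialCrossingPaths

end Literature.Probability.Percolation

end
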